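import Literature.Topology.Immersions.OpenParallelizableImmersionCritical
import Literature.Topology.Immersions.HolonomicApproxCube
import Mathlib.Geometry.Manifold.SmoothApprox
import Mathlib.Analysis.Calculus.BumpFunction.InnerProduct
import HarnessLib

/-!
# Open parallelizable manifolds immerse in `ℝⁿ`: extending a formal submersion over the core of
# a handle of index `< n`

Topic `Literature/Topology/Immersions`; the heart of the proof programme for the named fact
`Literature.Topology.Immersions.Phillips1967_exists_isLocalDiffeomorph_of_isParallelizable`
(Phillips 1967, Cor. 8.2, "if": *an open parallelizable `n`-manifold submerges in `ℝⁿ`*), in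
the formal-solution language of `OpenParallelizableImmersionInduction.lean`
(`HolonomicNear σ f Ψ U`) and the chart plumbing of `OpenParallelizableImmersionChart.lean`
(`chartDeriv`, the formal derivative read in a chart of the maximal atlas).

Phillips crosses a handle of index `λ < n` with his Lemmas 4.1 and 5.1 (§§4–6: the restriction
map `Sub(Dⁿ, ℝⁿ) → Sub(∂-collar, ℝⁿ)` has the covering homotopy property when `λ < p = n`).
We follow instead Gromov–Eliashberg–Mishachev: the formal submersion, holonomic near the closed
set `U` (the lower sublevel set), is made holonomic near `U ∪ D`, `D` the core disc of the
handle — here the unit cube `K = [-1, 1]ᵏ × 0` of a chart `e` of the maximal `C^∞` atlas whose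
rim `{∃ i < k, 1 - ρ ≤ |zᵢ|} ∩ plane` already lies in `U` — by the **relative holonomic
approximation theorem over a cube of positive codimension `k < n`**
(`Literature.Topology.Immersions.HolonomicApprox.holonomic_approx_cube`,
`HolonomicApproxCube.lean`; Eliashberg–Mishachev 2002, Thm. 3.1.2) applied in the chart to the
pair `(g ∘ e⁻¹, Â)` (smoothed), followed by the **openness / `Diff`-invariance of the
submersion relation** (EM 2002, §7.2, proof of Gromov's theorem for open manifolds): the new
map is `g' ∘ h` read back on `M` (`h` the `δ`-small wiggling diffeomorphism, `g'` the holonomic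
`ε`-approximation near `h(K)`), and the new formal derivative is
`(Â ∘ h + ρ₁ · (Dg' ∘ h - Â ∘ h)) ∘ Dh` for a bump `ρ₁` concentrated near `K` — a field of
invertible maps because `‖Dg' - Â‖ < ‖Â⁻¹‖⁻¹` on the tube and the perturbation is composed with
`Dh` only *after* the blend (no loss from `‖Dh‖ ≫ 1`). Holonomy near `U` is not destroyed: the
corrections `g' - f` vanish wherever `Df = A` at the projection to the plane (pointwise relative
clause of the cube theorem), which holds near `U` because `A` is chosen *equal* to `D(g ∘ e⁻¹)`
on a neighbourhood of the chart image of `U` (Mathlib's `Continuous.exists_contDiff_approx_and_eqOn`),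
while the shear `h` merely transports holonomic germs (`‖h - id‖` small).

* `Literature.Topology.Immersions.planePart k z` — the projection of `ℝⁿ` onto the coordinate
  `k`-plane (coordinates `≥ k` set to `0`), with its elementary metric properties.
* `Literature.Topology.Immersions.HolonomicNear.extend_cube` — **the handle step**: hypotheses
  `closedBall 0 (4n+4) ⊆ e.target`, the plane rim and beyond (`∃ i < k, 1 - ρ ≤ |zᵢ|`,
  `‖z‖ ≤ 4n+4`) maps into `U`, and `U` is *vertically convex* in the chart ball
  (`e⁻¹ z ∈ U ⟹ e⁻¹ (planePart k z) ∈ U`, as sublevel sets of a Morse function `c - |x|² + |y|²`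
  are); conclusion: a formal submersion holonomic near `U ∪ e⁻¹(K)`, `K = planeCube k 1`
  (`OpenParallelizableImmersionCritical.lean`), whose map and formal derivative are unchanged off
  `e⁻¹(ball 0 (4n+4))`.

Relation to the tree's other handle step. `OpenParallelizableImmersionCore.lean`
(`HolonomicNear.core`) with `OpenParallelizableImmersionCritical.lean`
(`HolonomicNear.criticalLevel`) and `HolonomicApproxCubeAdapter.lean` (`hasCubeCollarApprox`)
form a parallel route to the same step, organised around an *abstract* relative
holonomic-approximation property of a core/collar pair (`IsRelHolApprox`) in dimension `n + 2`.
The present theorem is the *direct* route in any dimension `n` (`k < n`): it consumes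
`holonomic_approx_cube` itself and replaces the collar bookkeeping by the vertical-convexity
hypothesis; its consumers are `HolonomicNear.extend_cubes` / `HolonomicNear.crossLevel`
(`OpenParallelizableImmersionLevel.lean`) and the discharge
`Phillips1967_exists_isLocalDiffeomorph_of_isParallelizable_holds`
(`OpenParallelizableImmersionHolds.lean`). The two routes share the chart plumbing
(`chartDeriv`, `contMDiff_extend_comp_chart`) and the cube `planeCube`.

## References

* A. Phillips, *Submersions of open manifolds*, Topology **6** (1967), 171–206: Lemmas 4.1, 5.1,
  §6. [Phillips1967]
* Y. Eliashberg, N. Mishachev, *Introduction to the h-principle*, GSM 48, AMS (2002), Thm. 3.1.2,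
  §7.2 (proof of Thm. 7.2.1/Gromov's theorem), §8.1. [EliashbergMishachev2002]
* Y. Eliashberg, N. Mishachev, *Holonomic approximation and Gromov's h-principle*,
  arXiv:math/0101196 (2001), Thm. 1.2.1, §2. [EliashbergMishachev2001]
-/

open scoped Manifold ContDiff Topology
open Set Function Filter Metric

noncomputable section

namespace Literature.Topology.Immersions

/-- Local notation: `𝔼 n` is the model Euclidean space `EuclideanSpace ℝ (Fin n)`. -/
local notation "𝔼 " n:arg => EuclideanSpace ℝ (Fin n)

variable {n : ℕ}

/-! ### Euclidean preliminaries -/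

section Euclid

/-- The projection onto the coordinate `k`-plane: the coordinates `i ≥ k` are set to `0`.
[folklore] -/
def planePart (k : ℕ) (z : 𝔼 n) : 𝔼 n :=
  WithLp.toLp 2 fun i => if i.val < k then z i else 0

/-- Evaluation of `planePart`. [folklore] -/
theorem planePart_apply (k : ℕ) (z : 𝔼 n) (i : Fin n) :
    planePart k z i = if i.val < k then z i else 0 := rfl

/-- Tangential coordinates are kept. [folklore] -/
theorem planePart_apply_of_lt {k : ℕ} (z : 𝔼 n) {i : Fin n} (hi : i.val < k) :
    planePart k z i = z i := by rw [planePart_apply, if_pos hi]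

/-- Normal coordinates are killed. [folklore] -/
theorem planePart_apply_of_le {k : ℕ} (z : 𝔼 n) {i : Fin n} (hi : k ≤ i.val) :
    planePart k z i = 0 := by rw [planePart_apply, if_neg (not_lt.2 hi)]

/-- A point of the plane is its own projection. [folklore] -/
theorem planePart_eq_self {k : ℕ} {z : 𝔼 n} (hz : ∀ i : Fin n, k ≤ i.val → z i = 0) :
    planePart k z = z := by
  ext i
  by_cases hi : i.val < k
  · exact planePart_apply_of_lt z hi
  · rw [planePart_apply_of_le z (not_lt.1 hi), hz i (not_lt.1 hi)]

/-- `planePart` is additive-linear: `planePart (z - w) = planePart z - planePart w`. [folklore] -/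
theorem planePart_sub (k : ℕ) (z w : 𝔼 n) : planePart k (z - w) = planePart k z - planePart k w := by
  ext i
  simp only [planePart_apply, PiLp.sub_apply]
  split_ifs <;> simp

/-- `‖planePart z‖ ≤ ‖z‖` (orthogonal projection). [folklore] -/
theorem norm_planePart_le (k : ℕ) (z : 𝔼 n) : ‖planePart k z‖ ≤ ‖z‖ := by
  have h : ‖planePart k z‖ ^ 2 ≤ ‖z‖ ^ 2 := by
    rw [EuclideanSpace.real_norm_sq_eq, EuclideanSpace.real_norm_sq_eq]
    refine Finset.sum_le_sum fun i _ => ?_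
    rw [planePart_apply]
    split_ifs
    · exact le_rfl
    · simp [sq_nonneg]
  exact (pow_le_pow_iff_left₀ (norm_nonneg _) (norm_nonneg _) two_ne_zero).1 h

/-- `planePart` is `1`-Lipschitz. [folklore] -/
theorem norm_planePart_sub_le (k : ℕ) (z w : 𝔼 n) : ‖planePart k z - planePart k w‖ ≤ ‖z - w‖ := by
  rw [← planePart_sub]; exact norm_planePart_le k _

/-- Sup-norm control gives norm control: `|zᵢ| ≤ a` for all `i` implies `‖z‖ ≤ a n`. [folklore] -/
theorem norm_le_of_forall_abs_le {z : 𝔼 n} {a : ℝ} (ha : 0 ≤ a) (h : ∀ i, |z i| ≤ a) :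
    ‖z‖ ≤ a * n := by
  have h1 : ‖z‖ ^ 2 ≤ (a * n) ^ 2 := by
    rw [EuclideanSpace.real_norm_sq_eq]
    calc ∑ i, z i ^ 2 ≤ ∑ _i : Fin n, a ^ 2 := Finset.sum_le_sum fun i _ => by
            rw [← sq_abs]; exact pow_le_pow_left₀ (abs_nonneg _) (h i) 2
      _ = n * a ^ 2 := by simp
      _ ≤ (a * n) ^ 2 := by
        have hn : (0 : ℝ) ≤ n := Nat.cast_nonneg _
        rcases Nat.eq_zero_or_pos n with h0 | hpos
        · subst h0; simp
        · have hn1 : (1 : ℝ) ≤ n := by exact_mod_cast hpos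
          nlinarith [sq_nonneg a]
  exact (pow_le_pow_iff_left₀ (norm_nonneg _) (by positivity) two_ne_zero).1 h1

/-- **Injectivity of small perturbations of an invertible map**: if `P` is invertible and
`‖Q - P‖ ‖P⁻¹‖ < 1` then `Q` has trivial kernel (`‖P u‖ ≥ ‖u‖/‖P⁻¹‖ > ‖(Q - P) u‖` for `u ≠ 0`).
[folklore] -/
theorem ker_eq_bot_of_norm_sub_mul_lt {E' : Type*} [NormedAddCommGroup E'] [NormedSpace ℝ E']
    {P Q : E' →L[ℝ] E'} (hP : P.IsInvertible) (h : ‖Q - P‖ * ‖P.inverse‖ < 1) :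
    LinearMap.ker (Q : E' →ₗ[ℝ] E') = ⊥ := by
  obtain ⟨L, rfl⟩ := hP
  rw [ContinuousLinearMap.inverse_equiv] at h
  rw [LinearMap.ker_eq_bot']
  intro u hu
  have hu' : (L : E' →L[ℝ] E') u = -((Q - (L : E' →L[ℝ] E')) u) := by
    have : Q u = 0 := hu
    simp only [FunLike.coe_sub, Pi.sub_apply, this, zero_sub, neg_neg]
  have h1 : ‖u‖ ≤ ‖(L.symm : E' →L[ℝ] E')‖ * ‖(L : E' →L[ℝ] E') u‖ := by
    calc ‖u‖ = ‖(L.symm : E' →L[ℝ] E') ((L : E' →L[ℝ] E') u)‖ := by simp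
      _ ≤ ‖(L.symm : E' →L[ℝ] E')‖ * ‖(L : E' →L[ℝ] E') u‖ := ContinuousLinearMap.le_opNorm _ _
  have h2 : ‖(L : E' →L[ℝ] E') u‖ ≤ ‖Q - (L : E' →L[ℝ] E')‖ * ‖u‖ := by
    rw [hu', norm_neg]; exact ContinuousLinearMap.le_opNorm _ _
  have h3 : ‖u‖ ≤ ‖Q - (L : E' →L[ℝ] E')‖ * ‖(L.symm : E' →L[ℝ] E')‖ * ‖u‖ := by
    calc ‖u‖ ≤ ‖(L.symm : E' →L[ℝ] E')‖ * ‖(L : E' →L[ℝ] E') u‖ := h1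
      _ ≤ ‖(L.symm : E' →L[ℝ] E')‖ * (‖Q - (L : E' →L[ℝ] E')‖ * ‖u‖) := by
        gcongr
      _ = ‖Q - (L : E' →L[ℝ] E')‖ * ‖(L.symm : E' →L[ℝ] E')‖ * ‖u‖ := by ring
  have h4 : (1 - ‖Q - (L : E' →L[ℝ] E')‖ * ‖(L.symm : E' →L[ℝ] E')‖) * ‖u‖ ≤ 0 := by linarith
  have h5 : 0 < 1 - ‖Q - (L : E' →L[ℝ] E')‖ * ‖(L.symm : E' →L[ℝ] E')‖ := by linarith
  have h6 : ‖u‖ ≤ 0 := by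
    by_contra hlt
    rw [not_le] at hlt
    linarith [mul_pos h5 hlt]
  exact norm_le_zero_iff.1 h6

/-- **A bump times a map smooth near the bump's support is smooth.** [folklore] -/
theorem contDiff_smul_of_contDiffOn {E' F' : Type*} [NormedAddCommGroup E'] [NormedSpace ℝ E']
    [NormedAddCommGroup F'] [NormedSpace ℝ F'] {χ : E' → ℝ} {u : E' → F'} {O : Set E'}
    (hχ : ContDiff ℝ ∞ χ) (hO : IsOpen O) (hsupp : tsupport χ ⊆ O) (hu : ContDiffOn ℝ ∞ u O) :
    ContDiff ℝ ∞ fun y => χ y • u y := by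
  rw [contDiff_iff_contDiffAt]
  intro y
  by_cases hy : y ∈ O
  · exact hχ.contDiffAt.smul (hu.contDiffAt (hO.mem_nhds hy))
  · have hy' : y ∉ tsupport χ := fun h' => hy (hsupp h')
    have hev : (fun y => χ y • u y) =ᶠ[𝓝 y] fun _ => 0 := by
      filter_upwards [notMem_tsupport_iff_eventuallyEq.1 hy'] with z hz
      simp [hz]
    exact contDiffAt_const.congr_of_eventuallyEq hev

/-- **A bump times a map continuous near the bump's support is continuous.** [folklore] -/
theorem continuous_smul_of_continuousOn {E' F' : Type*} [TopologicalSpace E']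
    [NormedAddCommGroup F'] [NormedSpace ℝ F'] {χ : E' → ℝ} {u : E' → F'} {O : Set E'}
    (hχ : Continuous χ) (hO : IsOpen O) (hsupp : tsupport χ ⊆ O) (hu : ContinuousOn u O) :
    Continuous fun y => χ y • u y := by
  rw [continuous_iff_continuousAt]
  intro y
  by_cases hy : y ∈ O
  · exact hχ.continuousAt.smul (hu.continuousAt (hO.mem_nhds hy))
  · have hy' : y ∉ tsupport χ := fun h' => hy (hsupp h')
    have hev : (fun y => χ y • u y) =ᶠ[𝓝 y] fun _ => 0 := by
      filter_upwards [notMem_tsupport_iff_eventuallyEq.1 hy'] with z hz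
      simp [hz]
    exact hev.continuousAt

/-- Blending identities in a module (stated abstractly so that they apply by `exact` to
operator-valued blends, whose scalar action is only definitionally the module one). [folklore] -/
theorem one_smul_add_sub_smul {F' : Type*} [AddCommGroup F'] [Module ℝ F'] (a b : F') :
    (1 : ℝ) • a + (1 - 1 : ℝ) • b = a := by simp

/-- Blending identity, weight `0`. [folklore] -/
theorem zero_smul_add_sub_smul {F' : Type*} [AddCommGroup F'] [Module ℝ F'] (a b : F') :
    (0 : ℝ) • a + (1 - 0 : ℝ) • b = b := by simp

/-- Blending identity, equal ends. [folklore] -/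
theorem smul_add_sub_smul_self {F' : Type*} [AddCommGroup F'] [Module ℝ F'] (r : ℝ) (a : F') :
    r • a + (1 - r) • a = a := by rw [← add_smul]; simp

/-- Interpolation identity, weight `1`. [folklore] -/
theorem add_one_smul_sub {F' : Type*} [AddCommGroup F'] [Module ℝ F'] (a b : F') :
    a + (1 : ℝ) • (b - a) = b := by simp

/-- Interpolation identity, equal ends. [folklore] -/
theorem add_smul_sub_self {F' : Type*} [AddCommGroup F'] [Module ℝ F'] (a : F') (r : ℝ) :
    a + r • (a - a) = a := by simp

/-- Interpolation identity, weight `0`. [folklore] -/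
theorem add_zero_smul_sub {F' : Type*} [AddCommGroup F'] [Module ℝ F'] (a b : F') :
    a + (0 : ℝ) • (b - a) = a := by simp

/-- Interpolation difference: `(a + r • x) - a = r • x` and its norm. [folklore] -/
theorem norm_add_smul_sub_le {F' : Type*} [NormedAddCommGroup F'] [NormedSpace ℝ F'] (a x : F')
    {r : ℝ} (hr : r ∈ Icc (0 : ℝ) 1) : ‖a + r • x - a‖ ≤ ‖x‖ := by
  rw [add_sub_cancel_left, norm_smul, Real.norm_eq_abs, abs_of_nonneg hr.1]
  exact mul_le_of_le_one_left (norm_nonneg _) hr.2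

end Euclid

/-! ### The handle step -/

section Handle

variable {M : Type*} [TopologicalSpace M] [ChartedSpace (EuclideanSpace ℝ (Fin n)) M]
  [IsManifold (𝓡 n) ∞ M] [T2Space M] {σ : Fin n → M → 𝔼 n}

set_option maxHeartbeats 1600000 in
/-- **The handle step of the induction: extending a formal submersion over the core of a handle
of index `k < n`** (Phillips 1967, Lemmas 4.1/5.1 and §6 — via Gromov–Eliashberg–Mishachev:
relative holonomic approximation over the cube `[-1, 1]ᵏ × 0 ⊂ ℝⁿ`,
`HolonomicApprox.holonomic_approx_cube`, EM 2002 Thm. 3.1.2, followed by the openness and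
`Diff`-invariance of the submersion relation, EM 2002 §7.2). Let `σ` be a continuous frame of the
`C^∞` `n`-manifold `M` (Hausdorff), `(g, Ψ)` a formal submersion holonomic near the closed set
`U`, `e` a chart of the maximal `C^∞` atlas with `closedBall 0 (4n + 4) ⊆ e.target`, `k < n`,
`0 < ρ < 1`. Assume that the points of the coordinate `k`-plane of the chart ball with some
`|zᵢ| ≥ 1 - ρ` (`i < k`) are mapped by `e⁻¹` into `U` (the rim of the core cube and beyond lie in
the region already dealt with), and that `U` is vertically convex in the chart ball
(`e⁻¹ z ∈ U ⟹ e⁻¹ (planePart k z) ∈ U`). Then there is a formal submersion `(g', Ψ')`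
holonomic near `U ∪ e⁻¹(K)`, `K = [-1, 1]ᵏ × 0` the unit cube of the plane, with `g' = g` and
`Ψ' = Ψ` off `e⁻¹(ball 0 (4n + 4))`. [cite: EliashbergMishachev2002, Thm. 3.1.2 and §7.2] -/
theorem HolonomicNear.extend_cube
    (hσ : ∀ i, Continuous fun x => (⟨x, σ i x⟩ : TangentBundle (𝓡 n) M))
    (hli : ∀ x, LinearIndependent ℝ fun i => σ i x)
    {g : M → 𝔼 n} {Ψ : M → Fin n → 𝔼 n} {U : Set M} (h : HolonomicNear σ g Ψ U)
    (hU : IsClosed U) {e : OpenPartialHomeomorph M (𝔼 n)}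
    (he : e ∈ IsManifold.maximalAtlas (𝓡 n) ∞ M)
    (hball : closedBall (0 : 𝔼 n) (4 * n + 4) ⊆ e.target) {k : ℕ} (hk : k < n) {ρ : ℝ}
    (hρ : 0 < ρ) (hρ1 : ρ < 1)
    (hrim : ∀ z : 𝔼 n, ‖z‖ ≤ 4 * n + 4 → (∀ l : Fin n, k ≤ l.val → z l = 0) →
      (∃ i : Fin n, i.val < k ∧ 1 - ρ ≤ |z i|) → e.symm z ∈ U)
    (hvert : ∀ z : 𝔼 n, ‖z‖ ≤ 4 * n + 4 → e.symm z ∈ U → e.symm (planePart k z) ∈ U) :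
    ∃ (g' : M → 𝔼 n) (Ψ' : M → Fin n → 𝔼 n),
      HolonomicNear σ g' Ψ' (U ∪ e.symm '' planeCube k 1) ∧
      (∀ x, x ∉ e.symm '' ball (0 : 𝔼 n) (4 * n + 4) → g' x = g x) ∧
      (∀ x, x ∉ e.symm '' ball (0 : 𝔼 n) (4 * n + 4) → Ψ' x = Ψ x) := by
  classical
  /- ───── Step 0: numerology, the holonomy region of `(g, Ψ)` ───── -/
  have hn1 : (1 : ℝ) ≤ n := by exact_mod_cast Nat.succ_le_of_lt (lt_of_le_of_lt (Nat.zero_le k) hk)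
  have hn0 : (0 : ℝ) ≤ n := by linarith
  obtain ⟨NU, hNUo, hUNU, hNUeq⟩ := h.exists_isOpen
  have hgs : ContMDiff (𝓡 n) (𝓡 n) ∞ g := h.contMDiff
  have hball' : ∀ {r : ℝ}, r ≤ 4 * n + 4 → closedBall (0 : 𝔼 n) r ⊆ e.target := fun hr =>
    (closedBall_subset_closedBall hr).trans hball
  have hmem_tgt : ∀ {z : 𝔼 n}, ‖z‖ ≤ 4 * n + 4 → z ∈ e.target := fun hz =>
    hball (mem_closedBall_zero_iff.2 hz)
  /- ───── Step 1: the chart readings `gE = g ∘ e⁻¹`, `𝒜 = chartDeriv` ───── -/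
  set gE : 𝔼 n → 𝔼 n := fun y => g (e.symm y) with hgE
  have hgEon : ContDiffOn ℝ ∞ gE e.target :=
    contMDiffOn_iff_contDiffOn.1 (hgs.comp_contMDiffOn (contMDiffOn_symm_of_mem_maximalAtlas he))
  set 𝒜 : 𝔼 n → 𝔼 n →L[ℝ] 𝔼 n := chartDeriv σ e Ψ with h𝒜
  have h𝒜cont : ContinuousOn 𝒜 e.target := continuousOn_chartDeriv he hσ hli h.continuous
  have h𝒜inv : ∀ y ∈ e.target, (𝒜 y).IsInvertible := fun y hy =>
    isInvertible_chartDeriv he hli h.linearIndependent hy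
  have h𝒜apply : ∀ x ∈ e.source, ∀ i, 𝒜 (e x) (frameDeriv σ e x i) = Ψ x i := fun x hx i =>
    chartDeriv_apply_frameDeriv he hli hx i
  -- holonomy read in the chart: on `e(source ∩ NU)`, `𝒜 = D gE`
  have h𝒜hol : ∀ x ∈ e.source, x ∈ NU → 𝒜 (e x) = fderiv ℝ gE (e x) := fun x hx hxN =>
    chartDeriv_eq_fderiv_of_eq he hli hx (hgs.mdifferentiableAt (by simp)) (hNUeq x hxN)
  /- ───── Step 2: the globalised map `f = χ₀ • gE` ───── -/
  set χ₀ : ContDiffBump (0 : 𝔼 n) := ⟨4 * n + 3, 4 * n + 4, by linarith, by linarith⟩ with hχ₀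
  set f : 𝔼 n → 𝔼 n := fun y => χ₀ y • gE y with hf
  have hfs : ContDiff ℝ ∞ f := by
    refine contDiff_smul_of_contDiffOn χ₀.contDiff e.open_target ?_ hgEon
    rw [χ₀.tsupport_eq]; exact hball
  have hfgE : ∀ y, ‖y‖ ≤ 4 * n + 3 → f y = gE y := fun y hy => by
    simp only [hf, χ₀.one_of_mem_closedBall (mem_closedBall_zero_iff.2 hy), one_smul]
  have hfgE_ev : ∀ y, ‖y‖ < 4 * n + 3 → f =ᶠ[𝓝 y] gE := fun y hy => by
    filter_upwards [Metric.isOpen_ball.mem_nhds (mem_ball_zero_iff.2 hy)] with w hw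
    exact hfgE w (le_of_lt (mem_ball_zero_iff.1 hw))
  have hDfgE : ∀ y, ‖y‖ < 4 * n + 3 → fderiv ℝ f y = fderiv ℝ gE y := fun y hy =>
    (hfgE_ev y hy).fderiv_eq
  -- `𝒜 = Df` on the chart image `GU` of the holonomy region inside the ball of radius `4n+3`
  set GU : Set (𝔼 n) := e.target ∩ e.symm ⁻¹' NU ∩ ball 0 (4 * n + 3) with hGU
  have hGUo : IsOpen GU :=
    (e.continuousOn_symm.isOpen_inter_preimage e.open_target hNUo).inter isOpen_ball
  have h𝒜Df : ∀ y ∈ GU, 𝒜 y = fderiv ℝ f y := by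
    rintro y ⟨⟨hyt, hyN⟩, hyb⟩
    have hx : e.symm y ∈ e.source := e.map_target hyt
    have := h𝒜hol (e.symm y) hx hyN
    rw [e.right_inv hyt] at this
    rw [this, hDfgE y (mem_ball_zero_iff.1 hyb)]
  /- ───── Step 3: the target `T` of the approximation and its smooth region ───── -/
  set Φ₁ : ContDiffBump (0 : 𝔼 n) := ⟨4 * n, 4 * n + 1, by linarith, by linarith⟩ with hΦ₁
  set T : 𝔼 n → 𝔼 n →L[ℝ] 𝔼 n := fun y => Φ₁ y • 𝒜 y + (1 - Φ₁ y) • fderiv ℝ f y with hT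
  have hTcont : Continuous T := by
    refine (continuous_smul_of_continuousOn Φ₁.continuous e.open_target ?_ h𝒜cont).add
      ((continuous_const.sub Φ₁.continuous).smul (hfs.continuous_fderiv (by simp)))
    rw [Φ₁.tsupport_eq]; exact hball' (by linarith)
  have hT𝒜 : ∀ y, ‖y‖ ≤ 4 * n → T y = 𝒜 y := fun y hy => by
    show Φ₁ y • 𝒜 y + (1 - Φ₁ y) • fderiv ℝ f y = 𝒜 y
    rw [Φ₁.one_of_mem_closedBall (mem_closedBall_zero_iff.2 hy)]
    exact one_smul_add_sub_smul _ _
  have hTDf_of_GU : ∀ y ∈ GU, T y = fderiv ℝ f y := fun y hy => by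
    show Φ₁ y • 𝒜 y + (1 - Φ₁ y) • fderiv ℝ f y = fderiv ℝ f y
    rw [h𝒜Df y hy]
    exact smul_add_sub_smul_self _ _
  have hTDf_far : ∀ y, 4 * n + 1 ≤ ‖y‖ → T y = fderiv ℝ f y := fun y hy => by
    have : Φ₁ y = 0 := Φ₁.zero_of_le_dist (by simpa using hy)
    show Φ₁ y • 𝒜 y + (1 - Φ₁ y) • fderiv ℝ f y = fderiv ℝ f y
    rw [this]
    exact zero_smul_add_sub_smul _ _
  -- the compact chart image `ZU` of `U` in the ball of radius `4n+2`, and its margin `θ`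
  set ZU : Set (𝔼 n) := closedBall 0 (4 * n + 2) ∩ e.symm ⁻¹' U with hZU
  have hZUc : IsCompact ZU :=
    (isCompact_closedBall _ _).of_isClosed_subset
      ((e.continuousOn_symm.mono (hball' (by linarith))).preimage_isClosed_of_isClosed
        isClosed_closedBall hU) inter_subset_left
  have hZUGU : ZU ⊆ GU := by
    rintro y ⟨hyb, hyU⟩
    have hyn : ‖y‖ ≤ 4 * n + 2 := mem_closedBall_zero_iff.1 hyb
    exact ⟨⟨hmem_tgt (by linarith), hUNU hyU⟩, mem_ball_zero_iff.2 (by linarith)⟩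
  obtain ⟨θ, hθpos, hθ1, hθGU⟩ : ∃ θ : ℝ, 0 < θ ∧ θ ≤ 1 ∧ cthickening θ ZU ⊆ GU := by
    obtain ⟨θ, hθpos, hθsub⟩ := hZUc.exists_cthickening_subset_open hGUo hZUGU
    exact ⟨min θ 1, by positivity, min_le_right _ _,
      (cthickening_mono (min_le_left _ _) _).trans hθsub⟩
  -- the closed set `Scl` on which `A = T` will be imposed, and its open neighbourhood `OS`
  set Scl : Set (𝔼 n) := cthickening (θ / 2) ZU ∪ (ball 0 (4 * n + 2))ᶜ with hScl
  set OS : Set (𝔼 n) := thickening θ ZU ∪ (closedBall 0 (4 * n + 1))ᶜ with hOS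
  have hSclc : IsClosed Scl := isClosed_cthickening.union isOpen_ball.isClosed_compl
  have hOSo : IsOpen OS := isOpen_thickening.union isClosed_closedBall.isOpen_compl
  have hSclOS : Scl ⊆ OS := by
    refine union_subset_union (cthickening_subset_thickening' hθpos (by linarith) ZU) ?_
    intro y hy hy'
    exact hy (closedBall_subset_ball (by linarith) hy')
  have hTDf_OS : ∀ y ∈ OS, T y = fderiv ℝ f y := by
    rintro y (hy | hy)
    · exact hTDf_of_GU y (hθGU (thickening_subset_cthickening θ ZU hy))
    · exact hTDf_far y (le_of_lt (not_le.1 fun h' => hy (mem_closedBall_zero_iff.2 h')))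
  have hTsmooth : ContDiffOn ℝ ∞ T OS :=
    ((hfs.fderiv_right (m := ∞) (by norm_cast)).contDiffOn).congr fun y hy => hTDf_OS y hy
  /- ───── Step 4: the uniform bound `C` on `‖𝒜⁻¹‖` over the ball of radius `4n+2` ───── -/
  obtain ⟨C, hCpos, hC⟩ : ∃ C : ℝ, 0 < C ∧ ∀ y, ‖y‖ ≤ 4 * n + 2 → ‖(𝒜 y).inverse‖ ≤ C := by
    have hcont : ContinuousOn (fun y => (𝒜 y).inverse) (closedBall (0 : 𝔼 n) (4 * n + 2)) := by
      intro y hy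
      have hyt : y ∈ e.target := hball' (by linarith) hy
      obtain ⟨L, hL⟩ := h𝒜inv y hyt
      have hinv : ContinuousAt ContinuousLinearMap.inverse (𝒜 y) := by
        rw [← hL]; exact (contDiffAt_map_inverse (n := 0) L).continuousAt
      exact hinv.comp_continuousWithinAt ((h𝒜cont y hyt).mono (hball' (by linarith)))
    obtain ⟨C, hC⟩ :=
      (isCompact_closedBall (0 : 𝔼 n) (4 * n + 2)).exists_bound_of_continuousOn hcont
    exact ⟨max C 1, by positivity, fun y hy =>
      (hC y (mem_closedBall_zero_iff.2 hy)).trans (le_max_left _ _)⟩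
  /- ───── Step 5: the smooth formal derivative `A` (approximation with exact agreement on `Scl`) ───── -/
  set ε' : ℝ := 1 / (4 * C) with hε'
  have hε'pos : 0 < ε' := by positivity
  obtain ⟨A, hAs, hAT, hAScl, -⟩ := hTcont.exists_contDiff_approx_and_eqOn (⊤ : ℕ∞) (ε := fun _ => ε')
    continuous_const (fun _ => hε'pos) hSclc (hOSo.mem_nhdsSet.2 hSclOS) hTsmooth
  -- the relative hypothesis of the cube theorem: `Df = A` on the plane off the inner cube
  have hol : ∀ z : 𝔼 n, (∀ l : Fin n, k ≤ l.val → z l = 0) →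
      (∃ i : Fin n, i.val < k ∧ 1 - ρ ≤ |z i|) → fderiv ℝ f z = A z := by
    intro z hzpl hzi
    have hzS : z ∈ Scl := by
      by_cases hzn : ‖z‖ < 4 * n + 2
      · left
        refine self_subset_cthickening ZU ⟨mem_closedBall_zero_iff.2 hzn.le, ?_⟩
        exact hrim z (by linarith) hzpl hzi
      · right
        exact fun h' => hzn (mem_ball_zero_iff.1 h')
    rw [hAScl hzS, hTDf_OS z (hSclOS hzS)]
  /- ───── Step 6: the cube theorem ───── -/
  set εc : ℝ := min (min 1 (θ / 8)) (1 / (4 * C)) with hεc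
  have hεcpos : 0 < εc := by positivity
  have hεc1 : εc ≤ 1 := (min_le_left _ _).trans (min_le_left _ _)
  have hεcθ : εc ≤ θ / 8 := (min_le_left _ _).trans (min_le_right _ _)
  have hεcC : εc ≤ 1 / (4 * C) := min_le_right _ _
  obtain ⟨g₁, hh, W, hg₁s, hhs, hWo, hKW, -, hder, hrimg, hoffg, hpt, hrimh, hoffh, hcoord,
    hWbd, hdisp, hinv⟩ :=
    HolonomicApprox.holonomic_approx_cube (G := 𝔼 n) hk hfs hAs hρ hρ1 hol hεcpos
  /- ───── Step 7: where things happen ───── -/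
  -- the tube is small
  have hWnorm : ∀ z ∈ W, ‖z‖ ≤ 2 * n := fun z hz => by
    obtain ⟨ht, hnl⟩ := hWbd z hz
    have := norm_le_of_forall_abs_le (a := 2) zero_le_two (z := z) fun i => by
      by_cases hi : i.val < k
      · have := ht i hi; linarith
      · exact (hnl i (not_lt.1 hi)).trans (by linarith)
    linarith
  -- the shear moves points only inside the ball of radius `2n`, by at most `εc`
  have hh_id : ∀ z : 𝔼 n, 2 * n < ‖z‖ → hh z = z := by
    intro z hz
    by_contra hne
    have h1 : ∀ i : Fin n, i.val < k → |z i| < 1 - ρ / 4 := fun i hi => by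
      by_contra hle; exact hne (hrimh z ⟨i, hi, not_lt.1 hle⟩)
    have h2 : ∀ l : Fin n, k ≤ l.val → |z l| < 2 := fun l hl => by
      by_contra hle; exact hne (hoffh z ⟨l, hl, not_lt.1 hle⟩)
    have := norm_le_of_forall_abs_le (a := 2) zero_le_two (z := z) fun i => by
      by_cases hi : i.val < k
      · have := h1 i hi; linarith
      · exact (h2 i (not_lt.1 hi)).le
    linarith
  have hh_near : ∀ z : 𝔼 n, ‖hh z - z‖ ≤ εc := hdisp
  have hh_norm : ∀ z : 𝔼 n, ‖hh z‖ ≤ ‖z‖ + 1 := fun z => by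
    have := norm_add_le (hh z - z) z
    rw [sub_add_cancel] at this
    linarith [hh_near z]
  have hh_fderiv_id : ∀ z : 𝔼 n, 2 * n < ‖z‖ →
      fderiv ℝ hh z = ContinuousLinearMap.id ℝ (𝔼 n) := by
    intro z hz
    have hev : hh =ᶠ[𝓝 z] id := by
      have ho : IsOpen {w : 𝔼 n | 2 * n < ‖w‖} := isOpen_lt continuous_const continuous_norm
      filter_upwards [ho.mem_nhds hz] with w hw
      exact hh_id w hw
    rw [hev.fderiv_eq, fderiv_id]
  -- the section differs from `f` only inside the ball of radius `2n`
  have hg₁f : ∀ z : 𝔼 n, 2 * n < ‖z‖ → g₁ z = f z := by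
    intro z hz
    by_contra hne
    have h1 : ∀ i : Fin n, i.val < k → |z i| < 1 - ρ := fun i hi => by
      by_contra hle; exact hne (hrimg z ⟨i, hi, not_lt.1 hle⟩)
    have h2 : ∀ l : Fin n, k ≤ l.val → |z l| < 2 := fun l hl => by
      by_contra hle; exact hne (hoffg z ⟨l, hl, not_lt.1 hle⟩)
    have := norm_le_of_forall_abs_le (a := 2) zero_le_two (z := z) fun i => by
      by_cases hi : i.val < k
      · have := h1 i hi; linarith
      · exact (h2 i (not_lt.1 hi)).le
    linarith
  -- the new chart-level map `G = g₁ ∘ h` and its difference with `f`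
  set G : 𝔼 n → 𝔼 n := fun z => g₁ (hh z) with hG
  have hGs : ContDiff ℝ ∞ G := hg₁s.comp hhs
  have hGf : ∀ z : 𝔼 n, 2 * n < ‖z‖ → G z = f z := fun z hz => by
    simp only [hG, hh_id z hz, hg₁f z hz]
  set d : 𝔼 n → 𝔼 n := fun z => G z - f z with hd
  have hds : ContDiff ℝ ∞ d := hGs.sub hfs
  have hdsupp : tsupport d ⊆ closedBall 0 (2 * n) := by
    refine closure_minimal (fun z hz => ?_) isClosed_closedBall
    rw [mem_closedBall_zero_iff]
    by_contra hlt
    exact hz (by simp only [hd, hGf z (not_le.1 hlt), sub_self])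
  /- ───── Step 8: the bump `ρ₁` concentrated near the cube, supported in `h⁻¹(W)` ───── -/
  have hKc : IsCompact (planeCube (m := n) k 1) := isCompact_planeCube k 1
  have hKpre : planeCube (m := n) k 1 ⊆ hh ⁻¹' W := fun z hz => hKW z hz.1 hz.2
  obtain ⟨ρ₁, hρ₁0, hρ₁1, hρ₁01⟩ := exists_contMDiffMap_zero_one_nhds_of_isClosed
    (I := 𝓘(ℝ, 𝔼 n)) (n := (⊤ : ℕ∞)) (hWo.preimage hhs.continuous).isClosed_compl hKc.isClosed
    (disjoint_compl_left_iff_subset.2 hKpre)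
  have hρ₁s : ContDiff ℝ ∞ (ρ₁ : 𝔼 n → ℝ) := ρ₁.contMDiff.contDiff
  have hρ₁W : ∀ z : 𝔼 n, ρ₁ z ≠ 0 → hh z ∈ W := fun z hz => by
    by_contra hW
    exact hz (hρ₁0.self_of_nhdsSet z hW)
  obtain ⟨OQ, hOQo, hKOQ, hOQ1⟩ := eventually_nhdsSet_iff_exists.1 hρ₁1
  have hρ₁norm : ∀ z : 𝔼 n, ρ₁ z ≠ 0 → ‖z‖ ≤ 2 * n + 1 := fun z hz => by
    have h1 := hWnorm _ (hρ₁W z hz)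
    have h2 := hh_near z
    have := norm_sub_norm_le z (hh z)
    rw [norm_sub_rev] at this
    linarith
  /- ───── Step 9: the new chart-level formal derivative ───── -/
  obtain ⟨Qop, hQop⟩ : ∃ Q : 𝔼 n → 𝔼 n →L[ℝ] 𝔼 n,
      ∀ z, Q z = 𝒜 (hh z) + ρ₁ z • (fderiv ℝ g₁ (hh z) - 𝒜 (hh z)) := ⟨_, fun z => rfl⟩
  obtain ⟨Anew, hAnew⟩ : ∃ A' : 𝔼 n → 𝔼 n →L[ℝ] 𝔼 n,
      ∀ z, A' z = (Qop z).comp (fderiv ℝ hh z) := ⟨_, fun z => rfl⟩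
  -- where nothing happens
  have hAnew_id : ∀ z : 𝔼 n, 2 * n + 1 < ‖z‖ → Anew z = 𝒜 z := by
    intro z hz
    have hρz : ρ₁ z = 0 := by
      by_contra hne; have := hρ₁norm z hne; linarith
    have hz' : 2 * n < ‖z‖ := by linarith
    rw [hAnew, hQop, hρz, hh_id z hz', hh_fderiv_id z hz', ContinuousLinearMap.comp_id]
    exact add_zero_smul_sub _ _
  -- `h` stays in the chart ball
  have hh_tgt : ∀ z : 𝔼 n, ‖z‖ < 4 * n + 1 → hh z ∈ e.target := fun z hz =>
    hmem_tgt (by linarith [hh_norm z])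
  -- continuity of `Anew` on the ball of radius `4n+1`
  have hAnew_cont : ContinuousOn Anew (ball 0 (4 * n + 1)) := by
    have h1 : ContinuousOn (fun z => 𝒜 (hh z)) (ball 0 (4 * n + 1)) :=
      h𝒜cont.comp hhs.continuous.continuousOn fun z hz => hh_tgt z (mem_ball_zero_iff.1 hz)
    have h2 : Continuous fun z => fderiv ℝ g₁ (hh z) :=
      (hg₁s.continuous_fderiv (by simp)).comp hhs.continuous
    have hQ : ContinuousOn Qop (ball 0 (4 * n + 1)) := by
      have : Qop = fun z => 𝒜 (hh z) + ρ₁ z • (fderiv ℝ g₁ (hh z) - 𝒜 (hh z)) := funext hQop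
      rw [this]
      exact h1.add ((hρ₁s.continuous.continuousOn).smul (h2.continuousOn.sub h1))
    have : Anew = fun z => (Qop z).comp (fderiv ℝ hh z) := funext hAnew
    rw [this]
    exact hQ.clm_comp (hhs.continuous_fderiv (by simp)).continuousOn
  /- ───── Step 10: the new pair on `M` ───── -/
  set O₁ : Set M := e.source ∩ e ⁻¹' ball 0 (4 * n + 1) with hO₁
  have hO₁o : IsOpen O₁ := e.continuousOn.isOpen_inter_preimage e.open_source isOpen_ball
  obtain ⟨Ψ₀, hΨ₀⟩ : ∃ P : M → Fin n → 𝔼 n, ∀ x i, P x i = Anew (e x) (frameDeriv σ e x i) :=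
    ⟨_, fun x i => rfl⟩
  obtain ⟨D, hD⟩ : ∃ D : M → Fin n → 𝔼 n, ∀ x, D x = if x ∈ O₁ then Ψ₀ x - Ψ x else 0 :=
    ⟨_, fun x => rfl⟩
  obtain ⟨corr, hcorr⟩ : ∃ c : M → 𝔼 n, ∀ x, c x = if x ∈ e.source then d (e x) else 0 :=
    ⟨_, fun x => rfl⟩
  set Ψ' : M → Fin n → 𝔼 n := fun x => Ψ x + D x with hΨ'
  set g' : M → 𝔼 n := fun x => g x + corr x with hg'
  have hΨ'O₁ : ∀ x ∈ O₁, Ψ' x = Ψ₀ x := fun x hx => by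
    show Ψ x + D x = Ψ₀ x
    rw [hD, if_pos hx]; abel
  have hΨ'off : ∀ x ∉ O₁, Ψ' x = Ψ x := fun x hx => by
    show Ψ x + D x = Ψ x
    rw [hD, if_neg hx, add_zero]
  have hΨ₀Ψ : ∀ x ∈ e.source, 2 * n + 1 < ‖e x‖ → Ψ₀ x = Ψ x := fun x hx hxn => by
    funext i
    rw [hΨ₀, hAnew_id (e x) hxn, h𝒜apply x hx i]
  have hD0 : ∀ x, (x ∈ e.source → 2 * n + 1 < ‖e x‖) → D x = 0 := fun x hx => by
    by_cases hxO : x ∈ O₁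
    · rw [hD, if_pos hxO, hΨ₀Ψ x hxO.1 (hx hxO.1), sub_self]
    · rw [hD, if_neg hxO]
  -- the map
  have hcorr_mem : ∀ x, corr x ≠ 0 → x ∈ e.source ∧ ‖e x‖ ≤ 2 * n := fun x hx => by
    by_cases hxs : x ∈ e.source
    · refine ⟨hxs, ?_⟩
      rw [hcorr, if_pos hxs] at hx
      exact mem_closedBall_zero_iff.1 (hdsupp (subset_tsupport _ hx))
    · rw [hcorr, if_neg hxs] at hx; exact absurd rfl hx
  have hcorr_fun : corr = fun x => if x ∈ e.source then d (e x) else 0 := funext hcorr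
  have hg's : ContMDiff (𝓡 n) (𝓡 n) ∞ g' := by
    show ContMDiff (𝓡 n) (𝓡 n) ∞ fun x => g x + corr x
    rw [hcorr_fun]
    exact hgs.add (contMDiff_extend_comp_chart he hds (isCompact_closedBall 0 (2 * n))
      (hball' (by linarith)) hdsupp)
  have hg'G : ∀ x ∈ e.source, ‖e x‖ < 4 * n + 3 → g' x = G (e x) := fun x hx hxn => by
    have : f (e x) = g x := by rw [hfgE _ hxn.le]; show g (e.symm (e x)) = g x; rw [e.left_inv hx]
    show g x + corr x = G (e x)
    rw [hcorr, if_pos hx]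
    show g x + (G (e x) - f (e x)) = G (e x)
    rw [this]; abel
  have hg'G_ev : ∀ x ∈ e.source, ‖e x‖ < 4 * n + 3 → g' =ᶠ[𝓝 x] fun x' => G (e x') := by
    intro x hx hxn
    have ho : IsOpen (e.source ∩ e ⁻¹' ball 0 (4 * n + 3)) :=
      e.continuousOn.isOpen_inter_preimage e.open_source isOpen_ball
    filter_upwards [ho.mem_nhds ⟨hx, mem_ball_zero_iff.2 hxn⟩] with x' hx'
    exact hg'G x' hx'.1 (mem_ball_zero_iff.1 hx'.2)
  have hframe_g' : ∀ x ∈ e.source, ‖e x‖ < 4 * n + 3 → ∀ i,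
      frameDeriv σ g' x i = fderiv ℝ G (e x) (frameDeriv σ e x i) := fun x hx hxn i => by
    rw [frameDeriv_congr_of_eventuallyEq (hg'G_ev x hx hxn)]
    exact frameDeriv_comp_chart he hx ((hGs.differentiable (by simp)).differentiableAt) i
  -- the formal derivative is continuous
  have hΨ₀cont : ContinuousOn Ψ₀ O₁ := by
    have : Ψ₀ = fun x i => Anew (e x) (frameDeriv σ e x i) := funext fun x => funext (hΨ₀ x)
    rw [this]
    refine continuousOn_pi.2 fun i => ?_
    have h1 : ContinuousOn (fun x => Anew (e x)) O₁ :=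
      hAnew_cont.comp (e.continuousOn.mono inter_subset_left) fun x hx => hx.2
    have h2 : ContinuousOn (fun x => frameDeriv σ e x i) O₁ :=
      ((continuousOn_pi.1 (continuousOn_frameDeriv_chart he hσ)) i).mono inter_subset_left
    exact h1.clm_apply h2
  set Bcl : Set M := e.symm '' closedBall (0 : 𝔼 n) (2 * n + 1) with hBcl
  have hBclc : IsClosed Bcl :=
    ((isCompact_closedBall _ _).image_of_continuousOn
      (e.continuousOn_symm.mono (hball' (by linarith)))).isClosed
  have hBclO₁ : Bcl ⊆ O₁ := by
    rintro x ⟨y, hy, rfl⟩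
    have hyn := mem_closedBall_zero_iff.1 hy
    have hyt : y ∈ e.target := hmem_tgt (by linarith)
    refine ⟨e.map_target hyt, ?_⟩
    show e (e.symm y) ∈ ball (0 : 𝔼 n) (4 * n + 1)
    rw [e.right_inv hyt]; exact mem_ball_zero_iff.2 (by linarith)
  have hD_off : ∀ x ∉ Bcl, D x = 0 := fun x hx => hD0 x fun hxs => by
    by_contra hle
    exact hx ⟨e x, mem_closedBall_zero_iff.2 (not_lt.1 hle), e.left_inv hxs⟩
  have hDcont : Continuous D := by
    rw [continuous_iff_continuousAt]
    intro x
    by_cases hx : x ∈ Bcl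
    · have hxO : x ∈ O₁ := hBclO₁ hx
      have hc : ContinuousOn D O₁ :=
        (hΨ₀cont.sub h.continuous.continuousOn).congr fun x' hx' => by
          rw [hD, if_pos hx']; rfl
      exact hc.continuousAt (hO₁o.mem_nhds hxO)
    · have hev : D =ᶠ[𝓝 x] fun _ => 0 := by
        filter_upwards [hBclc.isOpen_compl.mem_nhds hx] with x' hx'
        exact hD_off x' hx'
      exact hev.continuousAt
  have hΨ'cont : Continuous Ψ' := h.continuous.add hDcont
  /- ───── Step 11: linear independence of the new formal derivative ───── -/
  have hΨ'li : ∀ x, LinearIndependent ℝ (Ψ' x) := by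
    intro x
    by_cases hxO : x ∈ O₁
    · rw [hΨ'O₁ x hxO]
      obtain ⟨hxs, hxb⟩ := hxO
      have hzn : ‖e x‖ < 4 * n + 1 := mem_ball_zero_iff.1 hxb
      -- the frame pushed by `Dh` is a frame
      have hS := linearIndependent_frameDeriv_chart he hli hxs
      obtain ⟨Lh, hLh⟩ := hinv (e x)
      have hv : LinearIndependent ℝ fun i => fderiv ℝ hh (e x) (frameDeriv σ e x i) := by
        have key := hS.map' Lh.toLinearEquiv.toLinearMap Lh.toLinearEquiv.ker
        have key' : LinearIndependent ℝ fun i => (Lh : 𝔼 n →L[ℝ] 𝔼 n) (frameDeriv σ e x i) := key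
        rwa [hLh] at key'
      -- the blended operator is injective
      have hhz_tgt : hh (e x) ∈ e.target := hh_tgt (e x) hzn
      have hhz_norm : ‖hh (e x)‖ ≤ 4 * n + 2 := by linarith [hh_norm (e x)]
      have hP := h𝒜inv (hh (e x)) hhz_tgt
      have hdiff : ‖Qop (e x) - 𝒜 (hh (e x))‖ ≤ 1 / (2 * C) := by
        rw [hQop]
        have hle : ‖𝒜 (hh (e x)) + ρ₁ (e x) • (fderiv ℝ g₁ (hh (e x)) - 𝒜 (hh (e x))) -
            𝒜 (hh (e x))‖ ≤ ‖fderiv ℝ g₁ (hh (e x)) - 𝒜 (hh (e x))‖ :=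
          norm_add_smul_sub_le _ _ (hρ₁01 (e x))
        by_cases hρz : ρ₁ (e x) = 0
        · rw [hρz, add_zero_smul_sub, sub_self, norm_zero]; positivity
        · have hW : hh (e x) ∈ W := hρ₁W (e x) hρz
          have h1 : ‖fderiv ℝ g₁ (hh (e x)) - A (hh (e x))‖ ≤ εc := hder _ hW
          have h2 : ‖A (hh (e x)) - T (hh (e x))‖ < ε' := by rw [← dist_eq_norm]; exact hAT _
          have h3 : T (hh (e x)) = 𝒜 (hh (e x)) := hT𝒜 _ (by linarith [hWnorm _ hW])
          have h4 : ‖fderiv ℝ g₁ (hh (e x)) - 𝒜 (hh (e x))‖ ≤ εc + ε' := by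
            have := norm_sub_le_norm_sub_add_norm_sub (fderiv ℝ g₁ (hh (e x))) (A (hh (e x)))
              (𝒜 (hh (e x)))
            rw [← h3] at this ⊢
            linarith
          calc _ ≤ ‖fderiv ℝ g₁ (hh (e x)) - 𝒜 (hh (e x))‖ := hle
            _ ≤ εc + ε' := h4
            _ ≤ 1 / (4 * C) + 1 / (4 * C) := add_le_add hεcC le_rfl
            _ = 1 / (2 * C) := by field_simp; ring
      have hker : LinearMap.ker (Qop (e x) : 𝔼 n →ₗ[ℝ] 𝔼 n) = ⊥ := by
        refine ker_eq_bot_of_norm_sub_mul_lt hP ?_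
        calc ‖Qop (e x) - 𝒜 (hh (e x))‖ * ‖(𝒜 (hh (e x))).inverse‖ ≤ 1 / (2 * C) * C :=
              mul_le_mul hdiff (hC _ hhz_norm) (norm_nonneg _) (by positivity)
          _ = 1 / 2 := by field_simp
          _ < 1 := by norm_num
      have key := hv.map' (Qop (e x) : 𝔼 n →ₗ[ℝ] 𝔼 n) hker
      have hΨ₀x : Ψ₀ x = fun i => Qop (e x) (fderiv ℝ hh (e x) (frameDeriv σ e x i)) := by
        funext i; rw [hΨ₀, hAnew]; rfl
      rw [hΨ₀x]
      exact key
    · rw [hΨ'off x hxO]; exact h.linearIndependent x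
  /- ───── Step 12: holonomy near `U ∪ e⁻¹(K)` ───── -/
  have hθ8 : 0 < θ / 8 := by positivity
  have hhol : ∀ x₀ ∈ U ∪ e.symm '' planeCube k 1, ∀ᶠ x in 𝓝 x₀, Ψ' x = frameDeriv σ g' x := by
    rintro x₀ (hx₀U | ⟨z₀, hz₀K, rfl⟩)
    · by_cases hx₀B : x₀ ∈ e.symm '' closedBall (0 : 𝔼 n) (4 * n)
      · -- Case B2: `x₀ ∈ U` inside the chart ball
        obtain ⟨z₀, hz₀b, rfl⟩ := hx₀B
        have hz₀n : ‖z₀‖ ≤ 4 * n := mem_closedBall_zero_iff.1 hz₀b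
        have hz₀t : z₀ ∈ e.target := hmem_tgt (by linarith)
        have hz₀ZU : z₀ ∈ ZU := ⟨mem_closedBall_zero_iff.2 (by linarith), hx₀U⟩
        have hVo : IsOpen (e.source ∩ e ⁻¹' (thickening (θ / 8) ZU ∩ ball 0 (4 * n + 1))) :=
          e.continuousOn.isOpen_inter_preimage e.open_source (isOpen_thickening.inter isOpen_ball)
        have hx₀V : e.symm z₀ ∈ e.source ∩ e ⁻¹' (thickening (θ / 8) ZU ∩ ball 0 (4 * n + 1)) := by
          refine ⟨e.map_target hz₀t, ?_⟩
          show e (e.symm z₀) ∈ thickening (θ / 8) ZU ∩ ball 0 (4 * n + 1)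
          rw [e.right_inv hz₀t]
          exact ⟨mem_thickening_iff.2 ⟨z₀, hz₀ZU, by simpa using hθ8⟩,
            mem_ball_zero_iff.2 (by linarith)⟩
        filter_upwards [hVo.mem_nhds hx₀V] with x hx
        obtain ⟨hxs, hzth, hzb⟩ := hx
        have hzb' : ‖e x‖ < 4 * n + 1 := mem_ball_zero_iff.1 hzb
        obtain ⟨z₁, hz₁ZU, hzz₁⟩ := mem_thickening_iff.1 hzth
        have hz₁n : ‖z₁‖ ≤ 4 * n + 2 := mem_closedBall_zero_iff.1 hz₁ZU.1
        have hnear : dist (hh (e x)) (e x) ≤ εc := by rw [dist_eq_norm]; exact hh_near (e x)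
        -- (i) `h (e x)` lies in the holonomy region
        have hhzGU : hh (e x) ∈ GU := by
          refine hθGU (thickening_subset_cthickening θ ZU (mem_thickening_iff.2 ⟨z₁, hz₁ZU, ?_⟩))
          calc dist (hh (e x)) z₁ ≤ dist (hh (e x)) (e x) + dist (e x) z₁ := dist_triangle _ _ _
            _ < θ := by linarith
        have h𝒜hz : 𝒜 (hh (e x)) = fderiv ℝ f (hh (e x)) := h𝒜Df _ hhzGU
        -- (ii) `g₁ = f` near `h (e x)`
        have hg₁f_ball : ∀ w : 𝔼 n, dist w (hh (e x)) < θ / 8 → g₁ w = f w := by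
          intro w hw
          have hpw : planePart k w ∈ Scl := by
            left
            refine thickening_subset_cthickening _ _ (mem_thickening_iff.2 ⟨planePart k z₁, ?_, ?_⟩)
            · exact ⟨mem_closedBall_zero_iff.2 ((norm_planePart_le k z₁).trans hz₁n),
                hvert z₁ (by linarith) hz₁ZU.2⟩
            · calc dist (planePart k w) (planePart k z₁) ≤ dist w z₁ := by
                    rw [dist_eq_norm, dist_eq_norm]; exact norm_planePart_sub_le k w z₁
                _ ≤ dist w (hh (e x)) + dist (hh (e x)) (e x) + dist (e x) z₁ :=
                    dist_triangle4 _ _ _ _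
                _ < θ / 2 := by linarith
          have hApw : fderiv ℝ f (planePart k w) = A (planePart k w) := by
            rw [hAScl hpw, hTDf_OS _ (hSclOS hpw)]
          exact hpt w (planePart k w) (fun i hi => planePart_apply_of_lt w hi)
            (fun l hl => planePart_apply_of_le w hl) hApw
        have hg₁f_ev : g₁ =ᶠ[𝓝 (hh (e x))] f := by
          filter_upwards [Metric.ball_mem_nhds (hh (e x)) hθ8] with w hw
          exact hg₁f_ball w hw
        have hDg₁ : fderiv ℝ g₁ (hh (e x)) = fderiv ℝ f (hh (e x)) := hg₁f_ev.fderiv_eq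
        -- (iii) the blended operator is `𝒜 (h (e x))`
        have hQz : Qop (e x) = 𝒜 (hh (e x)) := by
          rw [hQop, hDg₁, ← h𝒜hz]
          exact add_smul_sub_self _ _
        -- (iv) `G = f ∘ h` near `e x`
        have hGev : G =ᶠ[𝓝 (e x)] fun w => f (hh w) := by
          have hc : ContinuousAt hh (e x) := hhs.continuous.continuousAt
          filter_upwards [hc.preimage_mem_nhds (Metric.ball_mem_nhds (hh (e x)) hθ8)] with w hw
          exact hg₁f_ball (hh w) hw
        have hDG : fderiv ℝ G (e x) = (fderiv ℝ f (hh (e x))).comp (fderiv ℝ hh (e x)) := by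
          rw [hGev.fderiv_eq]
          exact fderiv_comp (e x) ((hfs.differentiable (by simp)).differentiableAt)
            ((hhs.differentiable (by simp)).differentiableAt)
        -- conclusion
        rw [hΨ'O₁ x ⟨hxs, hzb⟩]
        funext i
        rw [hframe_g' x hxs (by linarith) i, hDG, hΨ₀, hAnew, hQz, h𝒜hz]
      · -- Case B1: `x₀ ∈ U` away from the chart ball: nothing changed near `x₀`
        have hB4c : IsClosed (e.symm '' closedBall (0 : 𝔼 n) (4 * n)) :=
          ((isCompact_closedBall _ _).image_of_continuousOn
            (e.continuousOn_symm.mono (hball' (by linarith)))).isClosed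
        filter_upwards [hNUo.mem_nhds (hUNU hx₀U), hB4c.isOpen_compl.mem_nhds hx₀B] with x hxN hxB
        have hfar : x ∈ e.source → 2 * n + 1 < ‖e x‖ := fun hxs => by
          by_contra hle
          exact hxB ⟨e x, mem_closedBall_zero_iff.2 (by linarith [not_lt.1 hle]), e.left_inv hxs⟩
        have hΨx : Ψ' x = Ψ x := by
          show Ψ x + D x = Ψ x
          rw [hD0 x hfar, add_zero]
        have hgev : g' =ᶠ[𝓝 x] g := by
          filter_upwards [hB4c.isOpen_compl.mem_nhds hxB] with x' hx'
          show g x' + corr x' = g x'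
          have : corr x' = 0 := by
            by_contra hne
            obtain ⟨hxs', hn'⟩ := hcorr_mem x' hne
            exact hx' ⟨e x', mem_closedBall_zero_iff.2 (by linarith), e.left_inv hxs'⟩
          rw [this, add_zero]
        rw [hΨx, frameDeriv_congr_of_eventuallyEq hgev, hNUeq x hxN]
    · -- Case A: near the cube, `ρ₁ = 1` and the pair is `(G, DG)` read back
      have hz₀n : ‖z₀‖ ≤ n := by
        have := norm_le_of_forall_abs_le (a := 1) zero_le_one (z := z₀) fun i => by
          by_cases hi : i.val < k
          · exact hz₀K.1 i hi
          · rw [hz₀K.2 i (not_lt.1 hi), abs_zero]; exact zero_le_one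
        linarith
      have hz₀t : z₀ ∈ e.target := hmem_tgt (by linarith)
      have hVo : IsOpen (e.source ∩ e ⁻¹' (OQ ∩ ball 0 (4 * n + 1))) :=
        e.continuousOn.isOpen_inter_preimage e.open_source (hOQo.inter isOpen_ball)
      have hx₀V : e.symm z₀ ∈ e.source ∩ e ⁻¹' (OQ ∩ ball 0 (4 * n + 1)) := by
        refine ⟨e.map_target hz₀t, ?_⟩
        show e (e.symm z₀) ∈ OQ ∩ ball 0 (4 * n + 1)
        rw [e.right_inv hz₀t]
        exact ⟨hKOQ hz₀K, mem_ball_zero_iff.2 (by linarith)⟩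
      filter_upwards [hVo.mem_nhds hx₀V] with x hx
      obtain ⟨hxs, hzQ, hzb⟩ := hx
      have hzb' : ‖e x‖ < 4 * n + 1 := mem_ball_zero_iff.1 hzb
      have hQz : Qop (e x) = fderiv ℝ g₁ (hh (e x)) := by
        rw [hQop, hOQ1 (e x) hzQ]
        exact add_one_smul_sub _ _
      have hDG : fderiv ℝ G (e x) = (fderiv ℝ g₁ (hh (e x))).comp (fderiv ℝ hh (e x)) :=
        fderiv_comp (e x) ((hg₁s.differentiable (by simp)).differentiableAt)
          ((hhs.differentiable (by simp)).differentiableAt)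
      rw [hΨ'O₁ x ⟨hxs, hzb⟩]
      funext i
      rw [hframe_g' x hxs (by linarith) i, hDG, hΨ₀, hAnew, hQz]
  /- ───── Step 13: assembling ───── -/
  refine ⟨g', Ψ', ⟨hg's, hΨ'cont, hΨ'li, eventually_nhdsSet_iff_forall.2 hhol⟩,
    fun x hx => ?_, fun x hx => ?_⟩
  · show g x + corr x = g x
    have : corr x = 0 := by
      by_contra hne
      obtain ⟨hxs, hxn⟩ := hcorr_mem x hne
      exact hx ⟨e x, mem_ball_zero_iff.2 (by linarith), e.left_inv hxs⟩
    rw [this, add_zero]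
  · show Ψ x + D x = Ψ x
    have : D x = 0 := hD0 x fun hxs => by
      by_contra hle
      exact hx ⟨e x, mem_ball_zero_iff.2 (by linarith [not_lt.1 hle]), e.left_inv hxs⟩
    rw [this, add_zero]

end Handle

end Literature.Topology.Immersions
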